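import Summits.KontsevichZagierPeriods.KontsevichZagierPeriods.Theorems.FurushoPentagonSectorToKernelSaAnalyticOffSmall
import Summits.KontsevichZagierPeriods.KontsevichZagierPeriods.Theorems.FurushoPentagonSectorToKernelAffineOpenBand
import Summits.KontsevichZagierPeriods.KontsevichZagierPeriods.Theorems.FurushoPentagonSectorToKernelCadRefine
import Summits.KontsevichZagierPeriods.KontsevichZagierPeriods.Theorems.FurushoPentagonSectorToKernelCadCellFacts
import Summits.KontsevichZagierPeriods.KontsevichZagierPeriods.Theorems.FurushoPentagonSectorToKernelNashCellStraighten
import Summits.KontsevichZagierPeriods.KontsevichZagierPeriods.Theorems.FurushoPentagonSectorToKernelNashCad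
import Summits.KontsevichZagierPeriods.KontsevichZagierPeriods.Theorems.FurushoPentagonSectorToKernelNashCellAssembly
import Summits.KontsevichZagierPeriods.KontsevichZagierPeriods.Theorems.HermiteRigidityReductionRigidityOfCubes
import Literature.NumberTheory.Transcendental.KZKernelConjectureForms
import Summits.KontsevichZagierPeriods.KontsevichZagierPeriods.Theorems.FurushoPentagonSectorToKernelCubeResolutionOfNash

/-!
# `SectorToKernel` (stmt-KontsevichZagierPeriods-10813), line `effective-cube-surjection`:
# `nashCellReduction` (unconditional) and the summit from open-cube resolution + Ayoub's conjecture

**Theorem `nashCellReduction`** (Bochnak–Coste–Roy Prop. 2.9.10 at the level of Kontsevich–Zagier MOVES,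
rules (1a) and (2) only).  Every bounded `ℚ`-semialgebraic volume `[K, 1]`, `K ⊆ ℝᵐ`, is congruent modulo
`KZ.relations` to a `ℤ`-combination of open-cube classes `[(0,1)ᵐ, J]` with `J` real analytic on the open
cube: the composition `nashCellReduction_of_nashCad ∘ nash_cad_of ∘ straighten_step_of` (the lead's stub F,
also landed as `stub_nashCellReductionOf`) applied to the four landed ingredients A (`stub_saAnalyticOffSmall`,
generic analyticity), B (`stub_affineOpenBand`, affine straightening of open bands), C (`stub_cadRefine`,
refinement of cylindrical decompositions), D (`stub_cadCellFacts`, cell facts).  This is VERBATIM the first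
registered stub `stub_nashCellReduction` of item stmt-KontsevichZagierPeriods-17978
(`HermiteRigidity.CubeResolution`, line `nash-rectilinearisation`), now a theorem.

**Consequences.**  `CubeResolution` (item 17978) follows from its SECOND registered stub alone, the open-cube
resolution statement (`cubeResolution_of_openCubeNashResolution`); hence the crux and the SUMMIT
`KontsevichZagierPeriods` follow from open-cube resolution (theorem-grade, Hironaka strength) together with
Ayoub's effective cube Conjecture 1.1 at `k = ℚ` (item stmt-18116, OPEN) — sharpening lead c18's
`kontsevichZagierPeriods_of_cubeResolution_of_ayoubEffectiveCubeKernel` (kernel form by `kernelForm_of_cubes`, summit by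
`kzKernelConjecture_iff_isRational` and `KontsevichZagierPeriods_iff`).
[Bochnak–Coste–Roy 1998, Prop. 2.9.10; Kontsevich–Zagier 2001, §1.2; Ayoub 2015, Conj. 1.1; Viu-Sos 2021, Thm. 1.1]
-/

noncomputable section

namespace Summit.KontsevichZagierPeriods.FurushoPentagon.SectorToKernel

open Set MeasureTheory
open Literature.ModelTheory.ExponentialFields
open Literature.NumberTheory.Transcendental
open Literature.NumberTheory.Transcendental.KZ hiding cubicalSpan
open Summit.KontsevichZagierPeriods.FurushoPentagon.ReducedPeriodRing (unitCube cubicalGens cubicalSpan)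
open Summit.KontsevichZagierPeriods.KontsevichZagierPeriods.Theses.FurushoPentagon
open Summit.KontsevichZagierPeriods.KontsevichZagierPeriods.Theses.HermiteRigidity (CubeResolution AyoubEffectiveCubeKernel)

/-- **Bounded volumes reduce to open-cube Nash classes** (= `stub_nashCellReduction` of item
stmt-KontsevichZagierPeriods-17978, unconditionally): every bounded `ℚ`-semialgebraic volume `[K, 1]` is
congruent modulo the Kontsevich–Zagier relations to a `ℤ`-combination of classes `[(0,1)ᵐ, J]`, `J` real
analytic on the open cube (cylindrical decomposition refined to have analytic walls over open cells, rule
(1a) across the cells, affine straightening of the open cells coordinate by coordinate, rule (2)).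
[cite: BochnakCosteRoy1998, Prop. 2.9.10] [cite: KontsevichZagier2001, §1.2 rules (1),(2)] -/
theorem nashCellReduction : ∀ (m : ℕ) (K : IntegralRep m), Bornology.IsBounded K.domain →
    (∀ x ∈ K.domain, K.integrand x = 1) →
    ∃ c ∈ AddSubgroup.closure {d : FormalRep | ∃ v : IntegralRep m,
      v.domain = {x : Fin m → ℝ | ∀ i, 0 < x i ∧ x i < 1} ∧
      AnalyticOnNhd ℝ v.integrand {x : Fin m → ℝ | ∀ i, 0 < x i ∧ x i < 1} ∧ d = of v},
      of K - c ∈ relations :=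
  nashCellReduction_of_nashCad stub_cadCellFacts.1
    (nash_cad_of stub_saAnalyticOffSmall stub_cadRefine stub_cadCellFacts.1 stub_cadCellFacts.2.1
      (fun hS'o hS's _ _ hlo_a hhi_a hlo_s hhi_s hlt IH r hdom han =>
        straighten_step_of hS'o hS's hlo_a hhi_a hlo_s hhi_s hlt stub_affineOpenBand IH r hdom han))

/-- Closure induction: if every generator of `S` is congruent modulo relations to an element of the subgroup
`T`, so is every element of `closure S`. [folklore] -/
theorem exists_mem_sub_mem_relations_of_mem_closure {S : Set FormalRep} {T : AddSubgroup FormalRep}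
    (h : ∀ s ∈ S, ∃ t ∈ T, s - t ∈ relations) :
    ∀ c ∈ AddSubgroup.closure S, ∃ t ∈ T, c - t ∈ relations := by
  intro c hc
  induction hc using AddSubgroup.closure_induction with
  | mem x hx => exact h x hx
  | zero => exact ⟨0, T.zero_mem, by simp⟩
  | add x y _ _ hx hy =>
    obtain ⟨a, ha, hxa⟩ := hx
    obtain ⟨b, hb, hyb⟩ := hy
    refine ⟨a + b, T.add_mem ha hb, ?_⟩
    have : x + y - (a + b) = (x - a) + (y - b) := by abel
    rw [this]
    exact relations.add_mem hxa hyb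
  | neg x _ hx =>
    obtain ⟨a, ha, hxa⟩ := hx
    refine ⟨-a, T.neg_mem ha, ?_⟩
    have : -x - -a = -(x - a) := by abel
    rw [this]
    exact relations.neg_mem hxa

/-- **`CubeResolution` (item stmt-KontsevichZagierPeriods-17978) from open-cube resolution alone**: with
`nashCellReduction` landed, the item follows from its second registered stub `stub_openCubeNashResolution`
(open-cube Nash classes resolve into the tame cubical span), via Viu-Sos (`cubeResolution_of_boundedVolumes`).
[cite: ViuSos2021, Thm. 1.1] [cite: BochnakCosteRoy1998, Prop. 2.9.10] -/
theorem cubeResolution_of_openCubeNashResolution :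
    (∀ (m : ℕ) (v : IntegralRep m),
      v.domain = {x : Fin m → ℝ | ∀ i, 0 < x i ∧ x i < 1} →
      AnalyticOnNhd ℝ v.integrand {x : Fin m → ℝ | ∀ i, 0 < x i ∧ x i < 1} →
      ∃ c ∈ AddSubgroup.closure {d : FormalRep | ∃ (n : ℕ) (r : IntegralRep n),
        r.domain = {x : Fin n → ℝ | ∀ i, 0 ≤ x i ∧ x i ≤ 1} ∧
        AnalyticOnNhd ℝ r.integrand {x : Fin n → ℝ | ∀ i, 0 ≤ x i ∧ x i ≤ 1} ∧ d = of r},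
        of v - c ∈ relations) →
    CubeResolution := by
  intro hres
  have hvol : ∀ (m : ℕ) (K : IntegralRep m), Bornology.IsBounded K.domain →
      (∀ x ∈ K.domain, K.integrand x = 1) → ∃ c : FormalRep, c ∈ cubicalSpan ∧ of K - c ∈ relations := by
    intro m K hb h1
    obtain ⟨c₁, hc₁, hK⟩ := nashCellReduction m K hb h1
    have hgen : ∀ s ∈ {d : FormalRep | ∃ v : IntegralRep m, v.domain = {x : Fin m → ℝ | ∀ i, 0 < x i ∧ x i < 1} ∧ AnalyticOnNhd ℝ v.integrand {x : Fin m → ℝ | ∀ i, 0 < x i ∧ x i < 1} ∧ d = of v}, ∃ t ∈ cubicalSpan, s - t ∈ relations := by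
      rintro s ⟨v, hvd, hva, rfl⟩
      obtain ⟨t, ht, hvt⟩ := hres m v hvd hva
      exact ⟨t, ht, hvt⟩
    obtain ⟨c₂, hc₂, h₁₂⟩ := exists_mem_sub_mem_relations_of_mem_closure hgen c₁ hc₁
    refine ⟨c₂, hc₂, ?_⟩
    have : of K - c₂ = (of K - c₁) + (c₁ - c₂) := by abel
    rw [this]
    exact relations.add_mem hK h₁₂
  intro N u
  obtain ⟨c, hc, huc⟩ := cubeResolution_of_boundedVolumes hvol N u
  exact ⟨c, hc, huc⟩

/-- **The crux from open-cube resolution and Ayoub's effective cube conjecture.** [cite: Ayoub2015, Conj. 1.1] -/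
theorem sectorToKernel_of_openCubeNashResolution_of_ayoubEffectiveCubeKernel :
    (∀ (m : ℕ) (v : IntegralRep m),
      v.domain = {x : Fin m → ℝ | ∀ i, 0 < x i ∧ x i < 1} →
      AnalyticOnNhd ℝ v.integrand {x : Fin m → ℝ | ∀ i, 0 < x i ∧ x i < 1} →
      ∃ c ∈ AddSubgroup.closure {d : FormalRep | ∃ (n : ℕ) (r : IntegralRep n),
        r.domain = {x : Fin n → ℝ | ∀ i, 0 ≤ x i ∧ x i ≤ 1} ∧
        AnalyticOnNhd ℝ r.integrand {x : Fin n → ℝ | ∀ i, 0 ≤ x i ∧ x i ≤ 1} ∧ d = of r},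
        of v - c ∈ relations) →
    AyoubEffectiveCubeKernel → SectorToKernel :=
  fun hres h6 _ _ => Summit.KontsevichZagierPeriods.HermiteRigidity.ReductionRigidityOfCubes.kernelForm_of_cubes
    (cubeResolution_of_openCubeNashResolution hres) h6

/-- **The SUMMIT from open-cube resolution and Ayoub's effective cube conjecture**: the period conjecture of
the tree (`KontsevichZagierPeriods`, the kernel form of Kontsevich–Zagier's Conjecture 1 for the calculus
`KZ.relations`) follows from (i) OPEN-CUBE RESOLUTION — every class `[(0,1)ᵐ, J]` with `J` real analytic on
the open cube is congruent modulo relations to a `ℤ`-combination of tame cube classes `[[0,1]ⁿ, f]`, `f`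
analytic near the closed cube (theorem-grade: rectilinearisation of the boundary singularities of a Nash
function by blow-ups and power substitutions, its last step being the landed `powerSubstToTame`) — and
(ii) Ayoub's effective cube Conjecture 1.1 at `k = ℚ` (item stmt-18116, OPEN).
[cite: Ayoub2015, Conj. 1.1] [cite: KontsevichZagier2001, §1.2] [cite: BochnakCosteRoy1998, Prop. 2.9.10] -/
theorem kontsevichZagierPeriods_of_openCubeNashResolution_of_ayoubEffectiveCubeKernel :
    (∀ (m : ℕ) (v : IntegralRep m),
      v.domain = {x : Fin m → ℝ | ∀ i, 0 < x i ∧ x i < 1} →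
      AnalyticOnNhd ℝ v.integrand {x : Fin m → ℝ | ∀ i, 0 < x i ∧ x i < 1} →
      ∃ c ∈ AddSubgroup.closure {d : FormalRep | ∃ (n : ℕ) (r : IntegralRep n),
        r.domain = {x : Fin n → ℝ | ∀ i, 0 ≤ x i ∧ x i ≤ 1} ∧
        AnalyticOnNhd ℝ r.integrand {x : Fin n → ℝ | ∀ i, 0 ≤ x i ∧ x i ≤ 1} ∧ d = of r},
        of v - c ∈ relations) →
    AyoubEffectiveCubeKernel → _root_.KontsevichZagierPeriods :=
  fun hres h6 => KontsevichZagierPeriods_iff.mpr (kzKernelConjecture_iff_isRational.mp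
    (Summit.KontsevichZagierPeriods.HermiteRigidity.ReductionRigidityOfCubes.kernelForm_of_cubes
      (cubeResolution_of_openCubeNashResolution hres) h6))

end Summit.KontsevichZagierPeriods.FurushoPentagon.SectorToKernel
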